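import Literature.Computability.AlgebraicComplexity.TwoRowRectangleKronecker
import Literature.Computability.AlgebraicComplexity.DIP20KeyDifferenceFormula
import HarnessLib

/-!
# Sylvester's theorem: unimodality of the Gaussian coefficients `p_k(ℓ, m)`, via Kronecker products

Topic `Literature/Computability/AlgebraicComplexity`; a PROOFS file (D-0014): theorems only.

I. Pak, G. Panova, *Unimodality via Kronecker products*, J. Algebraic Combin. 40 (2014) =
arXiv:1304.5044, §1: "The unimodality of the sequence `p_0(ℓ,m), p_1(ℓ,m), …, p_{ℓm}(ℓ,m)` is a
celebrated result first conjectured by Cayley in 1856, and proved by Sylvester in 1878" (their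
Thm. 1.1 with `r = 0`), where `p_n(ℓ, m)` is the number of partitions of `n` with at most `ℓ` parts
each at most `m` (the tree's `boxPartitionCount n ℓ m`, DIP20 `p_n(ℓ,m)`). Proof as in Pak–Panova
(Lemma 1.3, "The inequality `g(λ,μ,ν) ≥ 0` then implies unimodality"): by the tree's
`kroneckerCoeff_rectangle_rectangle_twoRow` (Sylvester's formula / the Main Lemma,
`TwoRowRectangleKronecker.lean`), `p_k(ℓ,m) - p_{k-1}(ℓ,m) = g((mˡ),(mˡ),(ℓm-k,k)) ≥ 0` for
`2k ≤ ℓm`; the decreasing half by the complement symmetry `p_k(ℓ,m) = p_{ℓm-k}(ℓ,m)`.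

Consequence for DIP20 (`DIP20KeyDifferenceFormula.lean`): hypothesis (H1) of
`DIP20_cor_4_8_of_gaussian_unimodality` (weak unimodality of `p_k(n+1, n-2)`) is discharged
(`DIP20_gaussian_weak_unimodality`), so the named fact `DIP20_cor_4_8` now rests exactly on the
STRICT unimodality (H2) (Pak–Panova 2013, not in the tree): `DIP20_cor_4_8_of_strict_unimodality`.

Honest framing (cell val-lit, seat t05): combinatorics; nothing here bears on VP ≠ VNP.

## References

* [PakPanova2014Unimodality] I. Pak, G. Panova, J. Algebraic Combin. 40 (2014) 1103–1120 =
  arXiv:1304.5044, §1 (Sylvester's theorem), Thm. 1.1, Lemma 1.3.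
* [DorflerIkenmeyerPanova2020] J. Dörfler, C. Ikenmeyer, G. Panova, SIAM J. Appl. Algebra Geom. 4
  (2020) = arXiv:1901.04576, §4 (`p_r(a,b)`), Cor. 4.8 and its proof (arXiv p. 12).
-/

noncomputable section

open scoped BigOperators
open Finset
open Literature.RingTheory.SymmetricFunctions.SymmPoly
open Literature.NumberTheory.DiophantineGeometry

namespace Literature.Computability.AlgebraicComplexity

/-- **Sylvester's theorem, increasing half**: `p_k(ℓ, m) ≤ p_{k+1}(ℓ, m)` whenever
`2(k+1) ≤ ℓm` — the difference is the Kronecker coefficient `g((mˡ), (mˡ), (ℓm-k-1, k+1)) ≥ 0`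
(Pak–Panova 2014, Lemma 1.3 and the sentence after Thm. 1.2). [cite: PakPanova2014Unimodality, §1 Thm. 1.1 (r = 0; Sylvester 1878) and Lemma 1.3] -/
theorem boxPartitionCount_le_succ {ℓ m k : ℕ} (hk : 2 * (k + 1) ≤ ℓ * m) :
    boxPartitionCount k ℓ m ≤ boxPartitionCount (k + 1) ℓ m := by
  have h := kroneckerCoeff_rectangle_rectangle_twoRow ℓ m (k + 1) hk
  rw [if_neg (Nat.succ_ne_zero k), Nat.add_sub_cancel] at h
  omega

/-- **Complement symmetry** `p_k(ℓ, m) = p_{ℓm-k}(ℓ, m)`: a partition in the `ℓ × m` box and its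
complement in the box (rotated by `180°`) determine each other (Pak–Panova 2014, Thm. 1.1: the
sequence is "symmetric"). [cite: PakPanova2014Unimodality, §1 Thm. 1.1 (r = 0)] -/
theorem boxPartitionCount_compl {ℓ m k : ℕ} (hk : k ≤ ℓ * m) :
    boxPartitionCount k ℓ m = boxPartitionCount (ℓ * m - k) ℓ m := by
  rw [← card_filter_antitoneWeights_le_eq_boxPartitionCount,
    ← card_filter_antitoneWeights_le_eq_boxPartitionCount]
  refine Finset.card_nbij' (fun α => fun j => m - α (Fin.rev j)) (fun α => fun j => m - α (Fin.rev j))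
    ?_ ?_ ?_ ?_
  · intro α hα
    rw [Finset.mem_coe, Finset.mem_filter] at hα ⊢
    exact ⟨boxCompl_mem_antitoneWeights m (r := ℓ * m - k) (s := k) (by omega) hα.1 hα.2,
      fun j => boxCompl_le m α j⟩
  · intro α hα
    rw [Finset.mem_coe, Finset.mem_filter] at hα ⊢
    exact ⟨boxCompl_mem_antitoneWeights m (r := k) (s := ℓ * m - k) (by omega) hα.1 hα.2,
      fun j => boxCompl_le m α j⟩
  · intro α hα
    rw [Finset.mem_coe, Finset.mem_filter] at hα
    exact boxCompl_boxCompl m hα.2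
  · intro α hα
    rw [Finset.mem_coe, Finset.mem_filter] at hα
    exact boxCompl_boxCompl m hα.2

/-- **Sylvester's theorem, decreasing half**: `p_{k+1}(ℓ, m) ≤ p_k(ℓ, m)` whenever `ℓm ≤ 2k`
(complement symmetry and the increasing half). [cite: PakPanova2014Unimodality, §1 Thm. 1.1 (r = 0; Sylvester 1878)] -/
theorem boxPartitionCount_succ_le {ℓ m k : ℕ} (hk : ℓ * m ≤ 2 * k) :
    boxPartitionCount (k + 1) ℓ m ≤ boxPartitionCount k ℓ m := by
  by_cases hk' : k + 1 ≤ ℓ * m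
  · rw [boxPartitionCount_compl hk', boxPartitionCount_compl (show k ≤ ℓ * m by omega)]
    have h := boxPartitionCount_le_succ (ℓ := ℓ) (m := m) (k := ℓ * m - k - 1) (by omega)
    rwa [show ℓ * m - k - 1 + 1 = ℓ * m - k by omega] at h
  · rw [boxPartitionCount_eq_zero_of_lt (by omega)]
    exact Nat.zero_le _

/-- **Sylvester's theorem (unimodality of the Gaussian coefficients)**: the sequence
`p_0(ℓ,m), p_1(ℓ,m), …, p_{ℓm}(ℓ,m)` of coefficients of the Gaussian binomial `binom(ℓ+m, ℓ)_q`
is unimodal with its maximum in the middle: increasing while `2(k+1) ≤ ℓm`, decreasing from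
`2k ≥ ℓm` on (Pak–Panova 2014, Thm. 1.1 with `r = 0`, "proved by Sylvester in 1878").
[cite: PakPanova2014Unimodality, §1 Thm. 1.1 (r = 0; Sylvester 1878)] -/
theorem boxPartitionCount_unimodal (ℓ m k : ℕ) :
    (2 * (k + 1) ≤ ℓ * m → boxPartitionCount k ℓ m ≤ boxPartitionCount (k + 1) ℓ m) ∧
      (ℓ * m ≤ 2 * k → boxPartitionCount (k + 1) ℓ m ≤ boxPartitionCount k ℓ m) :=
  ⟨boxPartitionCount_le_succ, boxPartitionCount_succ_le⟩

/-- Hypothesis (H1) of `DIP20_cor_4_8_of_gaussian_unimodality` — the weak unimodality of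
`p_k(n+1, n-2)` below the middle ("by the unimodality of the Gaussian coefficients", DIP20 proof of
Cor. 4.8) — holds. [cite: DorflerIkenmeyerPanova2020, Cor. 4.8 (proof, arXiv p. 12)] -/
theorem DIP20_gaussian_weak_unimodality (n k : ℕ) (hn : 2 ≤ n)
    (h : 2 * (n + k + 1) ≤ n ^ 2 + n - 2) :
    boxPartitionCount k (n + 1) (n - 2) ≤ boxPartitionCount (k + 1) (n + 1) (n - 2) := by
  refine boxPartitionCount_le_succ ?_
  obtain ⟨t, rfl⟩ : ∃ t, n = t + 2 := ⟨n - 2, by omega⟩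
  rw [show t + 2 - 2 = t from rfl]
  have h' : 2 * (t + 2 + k + 1) ≤ (t + 2) ^ 2 + (t + 2) - 2 := h
  ring_nf at h' ⊢
  omega

/-- **DIP20 Cor. 4.8 from strict Gaussian unimodality alone**: after Sylvester's theorem, the
named fact `DIP20_cor_4_8` rests exactly on the STRICT unimodality (H2) of `p_k(n+1, n-2)`
(Pak–Panova 2013, as corrected by the errata of the statement file).
[cite: DorflerIkenmeyerPanova2020, Cor. 4.8 (proof, arXiv p. 12)] -/
theorem DIP20_cor_4_8_of_strict_unimodality
    (H2 : ∀ n k : ℕ, 7 ≤ n → 1 ≤ k → 2 * (n + k + 1) ≤ n ^ 2 + n - 2 → (n, k) ≠ (8, 26) →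
      (n, k) ≠ (9, 34) → boxPartitionCount k (n + 1) (n - 2) < boxPartitionCount (k + 1) (n + 1) (n - 2)) :
    DIP20_cor_4_8 :=
  DIP20_cor_4_8_of_gaussian_unimodality (fun n k hn h => DIP20_gaussian_weak_unimodality n k hn h) H2

end Literature.Computability.AlgebraicComplexity
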